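import Summits.HodgeConjecture.HodgeConjecture.Theorems.Ring2DeformAnchoredFamilies
import Literature.AlgebraicGeometry.Pohlmann1968.SimpleCMAbelianVarietyPowersDivisorGenerated
import HarnessLib

/-!
# Ring 2 · deform axis, part XXII — the Tankeev–Ribet binder of parts IX / X DISCHARGED at the CM anchors:
# powers of a simple CM abelian variety of prime dimension (and realisations of a nondegenerate CM type) are
# free anchors of invariant-cycles families with NO named fact and NO `HC_CM`

HONEST FRAMING (cell `pub-hodge-ring2`, verbatim): research route conditional on HC_CM; not a corollary;
Q11.4-sentence-2 already refuted in dim ≥ 3.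

Cell `pub-hodge-ring2`, seat `pub-hodge-ring2-deform` (gen 96), supporting the OPEN item `CMToAbelian`
(stmt-HodgeConjecture-16267; nothing here closes it). `HC_CM` := the binder `Theses.RankFourFaces.CMAbelianHodge`
(stmt-HodgeConjecture-3052) does NOT occur in this file; neither does any named Literature fact.

WHY THIS PART (standing rule of the seat: kernel text is owed when a landed record dates an honest column of the
axis). Parts IX (`Ring2DeformAtlasSixfolds`) and X (`Ring2DeformAnchoredFamilies`) list the FREE ANCHORS of the
deformation axis — fibres of a Mumford–Tate / invariant-cycles family at which the Hodge conjecture is already a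
theorem of the tree, so that Abdulali's invariant-cycles property (1.1) (`InvariantCyclesHoldFor`, a PREDICATE on the
family) carries HC to the other fibres with `HC_CM` dispensable — and their honest column reads, for the charts
`A₀ ~ B^{N+1}` (`B` simple of prime dimension) and `X₀ ~ Y₀ × Z`, `Y₀ ~ B × B`, `Z ~ B` (`B` a simple surface):
«modulo the refereed named fact Tankeev–Ribet, binder `h : TankeevRibet1983_hodgeClasses_divisorial_powers_simplePrimeDimension`».
Cell `pub-hodgecm2` (literature seat `lit-deligne-3`, gen 5) has now PROVED the CM clause of that fact in the kernel,
unconditionally: `Pohlmann1968.hodgeConjectureFor_of_isIsogenous_powSucc_of_isSimple_of_isOfCMType_of_prime` — the Hodge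
conjecture for every complex abelian variety isogenous to a power `X^{N+1}` of a SIMPLE abelian variety `X` of CM type
and PRIME dimension (Yanai 1985: the CM type of `X` is nondegenerate; Hazama / White: nondegenerate ⟹ `B = D` on all
powers; Lefschetz `(1,1)`; isogeny invariance) — together with `Pohlmann1968.tankeevRibet1983_of_isOfCMType` (the CM
clause of the fact, in the fact's vocabulary) and `Pohlmann1968.tankeevRibet1983_iff_nonCM` (what the binder `h` still
carries is exactly the NON-CM case: simple abelian varieties of prime dimension of Albert types I–III / IV imaginary
quadratic). At the CM points of record of the free-anchor list (RING2-MAP §deform D.37, D.41: the Weyl CM points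
`~ B²` of the type III(1) sixfold families and the `B²` points of the `(1,1)³` sextic Weil families, `B` a simple CM
THREEFOLD; the `B²` points of the type III(1) fourfold Shimura curves and the K3-partner fibres `(B × B) × B` at `E`
cyclic, `B` a simple CM SURFACE) the factor `B` IS of CM type, so there the binder `h` is now dispensable. This part
records that dating as theorems of the exact shape of the part-IX / part-X rows with `h` replaced by
`hcm : IsOfCMType B` (§1 pointwise and anchor-locus form, §2 family form on an invariant-cycles family), and adds the
literature's standard unconditional CM anchors in the same two shapes: `A₀ ~ A^{N+1}`, `(A, ι, θ)` a realisation of a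
NONDEGENERATE CM type (Hazama / White, Gordon 1999 Thm. 6.4 and §9.3; §3,
`Pohlmann1968.IsNondegenerate.hodgeConjectureFor_of_isIsogenous_powSucc`). No definition, no `@[conjecture]` node,
no `sorry`; every proof is a one-term application (COUNT ONCE: the anchors' HC is cell pub-hodgecm2's theorem, cited by
name; the engines `cmSpreadingTo_of_invariantCycles_of_chart`, `hodgeConjectureFor_fiber_of_invariantCycles_of_chart_of_extend`
are part X's, `mem_anchorLocus_of_chart` / `cmSpreadingTo_of_mem_anchorLocus` typer 2's / part VII's).

Ledger (binders other than the chart and the deformation input (1.1)):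
* IX  `hodgeConjectureFor_of_isIsogenous_prod_sq_of_tankeevRibet`                        [h]  ↦ §1 `…_of_isOfCMType`  [hcm]
* IX  `cmSpreadingTo_of_chart_of_isIsogenous_powSucc_simplePrimeDim_of_tankeevRibet`      [h]  ↦ §1 `mem_anchorLocus_…` / `cmSpreadingTo_of_chart_…_of_isOfCMType` [hcm]
* IX  `cmSpreadingTo_of_chart_of_isIsogenous_prod_sq_of_tankeevRibet`                     [h]  ↦ §1 [hcm]
* X   `cmSpreadingTo_of_invariantCycles_of_chart_of_isIsogenous_powSucc_simplePrimeDim_of_tankeevRibet` [h] ↦ §2 [hcm]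
* X   `hodgeConjectureFor_fiber_of_invariantCycles_of_chart_simplePrimeDim_of_tankeevRibet_of_extend`  [h] ↦ §2 [hcm]
* X   `cmSpreadingTo_of_invariantCycles_of_chart_of_isIsogenous_prod_sq_of_tankeevRibet`   [h]  ↦ §2 [hcm]
* X   `hodgeConjectureFor_fiber_of_invariantCycles_of_chart_prod_sq_of_tankeevRibet_of_extend` [h] ↦ §2 [hcm]

What this does NOT say: that any particular family satisfies (1.1) (OPEN in relative dimension ≥ 4 outside the known
columns), that a given fibre is Hodge-generic (`HodgeClassesExtendAt`), which CM points lie on which family (RING2-MAP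
§deform D.41, taken here as the chart HYPOTHESIS `e₀`), nor anything about simple abelian varieties of prime dimension
that are NOT of CM type (there the rows of parts IX / X with the binder `h` — equivalently its non-CM restriction,
`Pohlmann1968.tankeevRibet1983_iff_nonCM` — remain the statement of record). The pointwise localised row U
`CMSpreadingAt A₀` at a CM fibre is not restated: it is VACUOUS there (part VII `cmSpreadingAt_of_isOfCMType`); the
content recorded here is ANCHOR-LOCUS membership (HC at the fibre) and what (1.1) then carries to the OTHER fibres.
Nothing here decides `HC_CM`, `HC_AV` or any atlas cell.

Sources: [Gordon 1999 = arXiv:alg-geom/9709030, Thm. 6.3 with Corollary and Remark, Thm. 6.4, §9.3];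
[Moonen–Zarhin 1999 = arXiv:math/9901113, §2 Thm. (2.7), §4 (arXiv p. 8)]; [Yanai 1985, Nagoya Math. J. 97, §4];
[van Geemen 1994, LNM 1594, §2.4–2.5, Lemma 3.7, Thm. 4.6]; [Abdulali 1994, (1.1) p. 1122 and Lemma 6.2 p. 1131];
[Deligne 1982, LNM 900, §6 Prop. 6.1]; [Charles–Schnell 2014 = arXiv:1101.3647, Prop. 11.3.5, Thm. 11.5.11].
-/

set_option linter.dupNamespace false

noncomputable section

namespace Summit.HodgeConjecture.HodgeConjecture.Ring2.Deform

open CategoryTheory AlgebraicGeometry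
open Literature.AlgebraicGeometry Literature.AlgebraicGeometry.Motives
open Literature.AlgebraicGeometry.HodgeTheory
open Literature.AlgebraicTopology.SingularHomology
open Literature.AlgebraicGeometry.Abdulali1994 (InvariantCyclesHoldFor)
open Literature.AlgebraicGeometry.Milne1999 (IsOfCMType)
open Literature.AlgebraicGeometry.ComplexMultiplication (IsCMTypeRealisation)
open Literature.AlgebraicGeometry.Pohlmann1968 (IsNondegenerate)
open Summit.HodgeConjecture.HodgeConjecture
open Summit.HodgeConjecture.HodgeConjecture.Ring2.Hypotheses (anchorLocus mem_anchorLocus_of_chart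
  HodgeClassesExtendAt)
open NumberField (IsCMField)
open scoped NumberField

/-! ## §1 — Pointwise and anchor-locus form: the CM anchors of parts VIII / IX, fact-free -/

/-- **The K3-partner CM fibre, fact-free**: HC for `X ~ Y₀ × Z` with `Y₀ ~ B × B`, `Z ~ B`, `B` a simple abelian
SURFACE of CM type (`X ~ B³ = B.powSucc 2`; the `E × E`-tori of the Shimura curve of a quartic-field type-IV fourfold
at `E` cyclic, RING2-MAP D.41) — part IX `hodgeConjectureFor_of_isIsogenous_prod_sq_of_tankeevRibet` with the
Tankeev–Ribet binder discharged by cell pub-hodgecm2's theorem (prime `2`).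
[cite: MoonenZarhin1999LowDim, §2 Thm. (2.7) and §4 (quartic-CM-field dichotomy, arXiv p. 8)]
[cite: Gordon1999HodgeAVSurvey, Thm. 6.3, Corollary and Remark] [cite: vanGeemen1994HodgeAV, Lemma 3.7] -/
theorem hodgeConjectureFor_of_isIsogenous_prod_sq_of_isOfCMType (B : AbelianVariety ℂ) (hB : B.dim = 2)
    (hs : B.IsSimple) (hcm : IsOfCMType B) {X Y₀ Z : AbelianVariety ℂ} (hX : X.IsIsogenous (Y₀.prod Z))
    (hY : Y₀.IsIsogenous (B.prod B)) (hZ : Z.IsIsogenous B) : HodgeConjectureFor X.dim X.X :=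
  Pohlmann1968.hodgeConjectureFor_of_isIsogenous_powSucc_of_isSimple_of_isOfCMType_of_prime (N := 2)
    Nat.prime_two hB hs hcm (hX.trans (hY.prod hZ))

variable {𝒳 S : SchemeOver ℂ}

/-- **A fibre charted by `A₀ ~ B^{N+1}`, `B` simple of CM type and PRIME dimension, is an ANCHOR — no named fact,
no `HC_CM`** (the Weyl CM points `~ B²` of the type III(1) sixfold families and of the `(1,1)³` sextic Weil
families, `B` a simple CM threefold; the `B²` points of the type III(1) fourfold Shimura curves, `B` a simple CM
surface: RING2-MAP D.37, D.41). [cite: Gordon1999HodgeAVSurvey, Thm. 6.3, Corollary and Remark]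
[cite: MoonenZarhin1999LowDim, §2 Thm. (2.7)] [cite: Abdulali1994FamiliesAV, proof of Lemma 6.2 (p. 1131)] -/
theorem mem_anchorLocus_of_chart_of_isIsogenous_powSucc_simplePrimeDim_of_isOfCMType {f : 𝒳 ⟶ S} {n : ℕ}
    {s : ComplexPoints S} (A₀ : AbelianVariety ℂ) (e₀ : A₀.X ≅ fiberOver f s) (hdim : A₀.dim = n)
    (B : AbelianVariety ℂ) {p : ℕ} (hp : p.Prime) (hB : B.dim = p) (hs : B.IsSimple) (hcm : IsOfCMType B)
    (N : ℕ) (hiso : A₀.IsIsogenous (B.powSucc N)) : s ∈ anchorLocus f n :=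
  mem_anchorLocus_of_chart e₀ (hdim ▸
    Pohlmann1968.hodgeConjectureFor_of_isIsogenous_powSucc_of_isSimple_of_isOfCMType_of_prime hp hB hs hcm hiso)

/-- **Family form, prime dimension, fact-free**: the localised row U to a fibre charted by `A₀ ~ B^{N+1}`, `B` simple
of CM type and prime dimension, is tautological — part IX
`cmSpreadingTo_of_chart_of_isIsogenous_powSucc_simplePrimeDim_of_tankeevRibet` with `h` discharged.
[cite: Gordon1999HodgeAVSurvey, Thm. 6.3, Corollary and Remark] [cite: Deligne1982HodgeCycles, §6 Prop. 6.1] -/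
theorem cmSpreadingTo_of_chart_of_isIsogenous_powSucc_simplePrimeDim_of_isOfCMType {f : 𝒳 ⟶ S} {n : ℕ}
    {s : ComplexPoints S} (A₀ : AbelianVariety ℂ) (e₀ : A₀.X ≅ fiberOver f s) (hdim : A₀.dim = n)
    (B : AbelianVariety ℂ) {p : ℕ} (hp : p.Prime) (hB : B.dim = p) (hs : B.IsSimple) (hcm : IsOfCMType B)
    (N : ℕ) (hiso : A₀.IsIsogenous (B.powSucc N)) : CMSpreadingTo f n s :=
  cmSpreadingTo_of_mem_anchorLocus
    (mem_anchorLocus_of_chart_of_isIsogenous_powSucc_simplePrimeDim_of_isOfCMType A₀ e₀ hdim B hp hB hs hcm N hiso)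

/-- **Family form, K3-partner cell at `E` cyclic, fact-free**: a fibre charted by `X₀ ~ Y₀ × Z`, `Y₀ ~ B × B`,
`Z ~ B`, `B` a simple CM surface, is an anchor, so the localised row U to it is tautological — part IX
`cmSpreadingTo_of_chart_of_isIsogenous_prod_sq_of_tankeevRibet` with `h` discharged.
[cite: MoonenZarhin1999LowDim, §4 (quartic-CM-field dichotomy, arXiv p. 8)] [cite: Deligne1982HodgeCycles, §6 Prop. 6.1] -/
theorem cmSpreadingTo_of_chart_of_isIsogenous_prod_sq_of_isOfCMType {f : 𝒳 ⟶ S} {n : ℕ}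
    {s : ComplexPoints S} (X₀ : AbelianVariety ℂ) (e₀ : X₀.X ≅ fiberOver f s) (hdim : X₀.dim = n)
    (B : AbelianVariety ℂ) (hB : B.dim = 2) (hs : B.IsSimple) (hcm : IsOfCMType B) {Y₀ Z : AbelianVariety ℂ}
    (hX : X₀.IsIsogenous (Y₀.prod Z)) (hY : Y₀.IsIsogenous (B.prod B)) (hZ : Z.IsIsogenous B) :
    CMSpreadingTo f n s :=
  cmSpreadingTo_of_mem_anchorLocus (mem_anchorLocus_of_chart e₀
    (hdim ▸ hodgeConjectureFor_of_isIsogenous_prod_sq_of_isOfCMType B hB hs hcm hX hY hZ))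

/-! ## §2 — Family form on an invariant-cycles family: the part-X rows with the binder `h` discharged -/

/-- **`B^{N+1}`-charted invariant-cycles families, `B` simple of CM type and prime dimension (no named fact, no
`HC_CM`)**: (1.1) on `f` and ONE fibre so charted give the localised row U at EVERY fibre of `f` — part X
`cmSpreadingTo_of_invariantCycles_of_chart_of_isIsogenous_powSucc_simplePrimeDim_of_tankeevRibet` with `h`
discharged. [cite: Gordon1999HodgeAVSurvey, Thm. 6.3, Corollary and Remark]
[cite: Abdulali1994FamiliesAV, (1.1) (p. 1122) and Lemma 6.2 (p. 1131)] -/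
theorem cmSpreadingTo_of_invariantCycles_of_chart_of_isIsogenous_powSucc_simplePrimeDim_of_isOfCMType
    {f : 𝒳 ⟶ S} {n : ℕ} (hIC : InvariantCyclesHoldFor f n) {s₀ : ComplexPoints S} (A₀ : AbelianVariety ℂ)
    (e₀ : A₀.X ≅ fiberOver f s₀) (hdim : A₀.dim = n) (B : AbelianVariety ℂ) {p : ℕ} (hp : p.Prime)
    (hB : B.dim = p) (hs : B.IsSimple) (hcm : IsOfCMType B) (N : ℕ) (hiso : A₀.IsIsogenous (B.powSucc N))
    (s₁ : ComplexPoints S) : CMSpreadingTo f n s₁ :=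
  cmSpreadingTo_of_invariantCycles_of_chart hIC e₀ (hdim ▸
    Pohlmann1968.hodgeConjectureFor_of_isIsogenous_powSucc_of_isSimple_of_isOfCMType_of_prime hp hB hs hcm hiso) s₁

/-- … and HC holds at every Hodge-generic fibre of such a family — part X
`hodgeConjectureFor_fiber_of_invariantCycles_of_chart_simplePrimeDim_of_tankeevRibet_of_extend` with `h` discharged.
[cite: Gordon1999HodgeAVSurvey, Thm. 6.3, Corollary and Remark] [cite: Abdulali1994FamiliesAV, Lemma 6.2 (p. 1131)]
[cite: CharlesSchnell2014Notes, Prop. 11.3.5] -/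
theorem hodgeConjectureFor_fiber_of_invariantCycles_of_chart_simplePrimeDim_of_isOfCMType_of_extend
    {f : 𝒳 ⟶ S} {n : ℕ} (hf : IsSmoothProjectiveFamily f n) (hIC : InvariantCyclesHoldFor f n)
    {s₀ : ComplexPoints S} (A₀ : AbelianVariety ℂ) (e₀ : A₀.X ≅ fiberOver f s₀) (hdim : A₀.dim = n)
    (B : AbelianVariety ℂ) {p : ℕ} (hp : p.Prime) (hB : B.dim = p) (hs : B.IsSimple) (hcm : IsOfCMType B) (N : ℕ)
    (hiso : A₀.IsIsogenous (B.powSucc N)) {s : ComplexPoints S} (hgen : HodgeClassesExtendAt f n s) :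
    HodgeConjectureFor n (fiberOver f s) :=
  hodgeConjectureFor_fiber_of_invariantCycles_of_chart_of_extend hf hIC e₀ (hdim ▸
    Pohlmann1968.hodgeConjectureFor_of_isIsogenous_powSucc_of_isSimple_of_isOfCMType_of_prime hp hB hs hcm hiso) hgen

/-- **K3-partner invariant-cycles families at `E` cyclic, chart `X₀ ~ Y₀ × Z`, `Y₀ ~ B × B`, `Z ~ B`, `B` a simple CM
surface (no named fact, no `HC_CM`)**: (1.1) on `f` gives the localised row U at every fibre — part X
`cmSpreadingTo_of_invariantCycles_of_chart_of_isIsogenous_prod_sq_of_tankeevRibet` with `h` discharged.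
[cite: MoonenZarhin1999LowDim, §4 (quartic-CM-field dichotomy, arXiv p. 8)]
[cite: Abdulali1994FamiliesAV, (1.1) (p. 1122) and Lemma 6.2 (p. 1131)] -/
theorem cmSpreadingTo_of_invariantCycles_of_chart_of_isIsogenous_prod_sq_of_isOfCMType {f : 𝒳 ⟶ S} {n : ℕ}
    (hIC : InvariantCyclesHoldFor f n) {s₀ : ComplexPoints S} (X₀ : AbelianVariety ℂ)
    (e₀ : X₀.X ≅ fiberOver f s₀) (hdim : X₀.dim = n) (B : AbelianVariety ℂ) (hB : B.dim = 2) (hs : B.IsSimple)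
    (hcm : IsOfCMType B) {Y₀ Z : AbelianVariety ℂ} (hX : X₀.IsIsogenous (Y₀.prod Z))
    (hY : Y₀.IsIsogenous (B.prod B)) (hZ : Z.IsIsogenous B) (s₁ : ComplexPoints S) : CMSpreadingTo f n s₁ :=
  cmSpreadingTo_of_invariantCycles_of_chart hIC e₀
    (hdim ▸ hodgeConjectureFor_of_isIsogenous_prod_sq_of_isOfCMType B hB hs hcm hX hY hZ) s₁

/-- … and HC holds at every Hodge-generic fibre of such a family — part X
`hodgeConjectureFor_fiber_of_invariantCycles_of_chart_prod_sq_of_tankeevRibet_of_extend` with `h` discharged: the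
K3-partner cell at `E` cyclic is carried by (1.1) on ONE Shimura curve with NO further input.
[cite: MoonenZarhin1999LowDim, §4 (quartic-CM-field dichotomy, arXiv p. 8)]
[cite: Abdulali1994FamiliesAV, Lemma 6.2 (p. 1131)] [cite: CharlesSchnell2014Notes, Thm. 11.5.11 (a)–(c)] -/
theorem hodgeConjectureFor_fiber_of_invariantCycles_of_chart_prod_sq_of_isOfCMType_of_extend {f : 𝒳 ⟶ S}
    {n : ℕ} (hf : IsSmoothProjectiveFamily f n) (hIC : InvariantCyclesHoldFor f n) {s₀ : ComplexPoints S}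
    (X₀ : AbelianVariety ℂ) (e₀ : X₀.X ≅ fiberOver f s₀) (hdim : X₀.dim = n) (B : AbelianVariety ℂ)
    (hB : B.dim = 2) (hs : B.IsSimple) (hcm : IsOfCMType B) {Y₀ Z : AbelianVariety ℂ}
    (hX : X₀.IsIsogenous (Y₀.prod Z)) (hY : Y₀.IsIsogenous (B.prod B)) (hZ : Z.IsIsogenous B)
    {s : ComplexPoints S} (hgen : HodgeClassesExtendAt f n s) : HodgeConjectureFor n (fiberOver f s) :=
  hodgeConjectureFor_fiber_of_invariantCycles_of_chart_of_extend hf hIC e₀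
    (hdim ▸ hodgeConjectureFor_of_isIsogenous_prod_sq_of_isOfCMType B hB hs hcm hX hY hZ) hgen

/-! ## §3 — The literature's own free anchors: powers of a realisation of a NONDEGENERATE CM type -/

section Nondegenerate

variable {K : Type} [Field K] [NumberField K] [IsCMField K] {Φ : CMType K}
variable {A : AbelianVariety ℂ} {ι : 𝓞 K →+* End A} {θ : K →+* Module.End ℂ (complexBetti A.X 1)}

/-- **A fibre charted by `A₀ ~ A^{N+1}`, `(A, ι, θ)` a realisation of a NONDEGENERATE CM type `(K; Φ)`, is an anchor —
no named fact, no `HC_CM`** (Hazama / White: `B(A^{N+1}) = D(A^{N+1})`, Lefschetz `(1,1)`, isogeny invariance).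
[cite: Gordon1999HodgeAVSurvey, Thm. 6.4 and §9.3]
[cite: vanGeemen1994HodgeAV, Lemma 3.7] [cite: Abdulali1994FamiliesAV, proof of Lemma 6.2 (p. 1131)] -/
theorem mem_anchorLocus_of_chart_of_isIsogenous_powSucc_of_isNondegenerate (hΦ : IsNondegenerate Φ)
    (hA : IsCMTypeRealisation Φ A ι θ) {f : 𝒳 ⟶ S} {n : ℕ} {s : ComplexPoints S} (A₀ : AbelianVariety ℂ)
    (e₀ : A₀.X ≅ fiberOver f s) (hdim : A₀.dim = n) {N : ℕ} (hiso : A₀.IsIsogenous (A.powSucc N)) :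
    s ∈ anchorLocus f n :=
  mem_anchorLocus_of_chart e₀ (hdim ▸ hΦ.hodgeConjectureFor_of_isIsogenous_powSucc hA hiso)

/-- **`A^{N+1}`-charted invariant-cycles families, `A` a realisation of a nondegenerate CM type (no named fact, no
`HC_CM`)**: (1.1) on `f` and ONE fibre so charted give the localised row U at EVERY fibre of `f` ("(1.1) + one
good fibre", the good fibre supplied by the tree). [cite: Gordon1999HodgeAVSurvey, Thm. 6.4 and §9.3]
[cite: Abdulali1994FamiliesAV, (1.1) (p. 1122) and Lemma 6.2 (p. 1131)] [cite: Deligne1982HodgeCycles, §6 Prop. 6.1] -/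
theorem cmSpreadingTo_of_invariantCycles_of_chart_of_isIsogenous_powSucc_of_isNondegenerate
    (hΦ : IsNondegenerate Φ) (hA : IsCMTypeRealisation Φ A ι θ) {f : 𝒳 ⟶ S} {n : ℕ}
    (hIC : InvariantCyclesHoldFor f n) {s₀ : ComplexPoints S} (A₀ : AbelianVariety ℂ)
    (e₀ : A₀.X ≅ fiberOver f s₀) (hdim : A₀.dim = n) {N : ℕ} (hiso : A₀.IsIsogenous (A.powSucc N))
    (s₁ : ComplexPoints S) : CMSpreadingTo f n s₁ :=
  cmSpreadingTo_of_invariantCycles_of_chart hIC e₀ (hdim ▸ hΦ.hodgeConjectureFor_of_isIsogenous_powSucc hA hiso) s₁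

/-- … and HC holds at every Hodge-generic fibre of such a family. [cite: Gordon1999HodgeAVSurvey, Thm. 6.4 and §9.3]
[cite: Abdulali1994FamiliesAV, Lemma 6.2 (p. 1131)] [cite: CharlesSchnell2014Notes, Prop. 11.3.5] -/
theorem hodgeConjectureFor_fiber_of_invariantCycles_of_chart_of_isNondegenerate_of_extend
    (hΦ : IsNondegenerate Φ) (hA : IsCMTypeRealisation Φ A ι θ) {f : 𝒳 ⟶ S} {n : ℕ}
    (hf : IsSmoothProjectiveFamily f n) (hIC : InvariantCyclesHoldFor f n) {s₀ : ComplexPoints S}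
    (A₀ : AbelianVariety ℂ) (e₀ : A₀.X ≅ fiberOver f s₀) (hdim : A₀.dim = n) {N : ℕ}
    (hiso : A₀.IsIsogenous (A.powSucc N)) {s : ComplexPoints S} (hgen : HodgeClassesExtendAt f n s) :
    HodgeConjectureFor n (fiberOver f s) :=
  hodgeConjectureFor_fiber_of_invariantCycles_of_chart_of_extend hf hIC e₀
    (hdim ▸ hΦ.hodgeConjectureFor_of_isIsogenous_powSucc hA hiso) hgen

end Nondegenerate

end Summit.HodgeConjecture.HodgeConjecture.Ring2.Deform
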